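import Mathlib
import Literature.MathematicalPhysics.QuantumFieldTheory.Balaban1983to89.T4ComplexDilation

/-!
# T4DilationAperture — the APERTURE `c` of the NOT-PRINTED dilation hypothesis [H-dil-N] of node U3 (estimate NE9), PRICED IN
KERNEL on the one-block model of `T4ComplexDilation`: (i) on the DOMINATION route (absolute values inside the integral, the
volume factor `(1 − c²)^{−n/4}` as the whole price) a LOCALISED family with `ν` fluctuation variables per unit of size and
real-coupling decay rate `κ` keeps exponential decay on the dilation discs `|z − s| ≤ c·s` iff the aperture is below
`c_*(κ, ν) = √(1 − e^{−4κ/ν})`, `4κ/(ν + 4κ) < c_*² ≤ 4κ/ν` — TWO-SIDED: sufficiency for genuine `act` families in the literal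
`hlast` shape with decay rate `κ − a(c)·ν`, `a(c) = −¼·log(1 − c²) ∈ [c²/4, c²/(4(1 − c²))]`, and an HONEST family attaining the
rate loss `a(c)·ν` on every disc; the Cauchy ⇒ Lipschitz constant inherits the prefactor `e^{a(c)ν}/c ≥ √(eν/2)` whatever the
aperture —; (ii) the volume factor is a feature of DOMINATION, not of dilation: for translation-character (Fourier /
Wiener-class) insertions under the free quadratic action, exact Gaussian Fourier integration gives `‖act z‖ ≤ Σ|a_m|` for EVERY
`Re z > 0`, uniformly in the number of variables, while the domination bound for the same object is `≥ e^{n c²/4}` (cell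
`pub-balaban`, T4-DAG §2 node U3 / §6 NE9; journal row T4-U3.E-NE9-PROVE-P1j*; MODEL statements about toy functionals with
explicit constants, NO estimate of the cell's NEW-ESTIMATE kind for Bałaban's activities, NOT summit progress).

HONEST FRAMING (T4-DAG PAGE 1).  The cell's T4 target is rung (B)+1: existence AND uniqueness of the ε → 0 limit of
Bałaban's unit-scale averaged expectations on a FIXED finite torus — strictly beyond ultraviolet stability
([Balaban1988Convergent] Cor. 3 p. 264; [Balaban1989LargeFieldII] Thm 1 p. 355), and NOT infinite volume, NOT a mass gap,
NOT the Clay problem; the hypotheses BetaPertH, (B), (B^μ) of the cell's chain stay explicit and are untouched here (this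
module uses none of them).  NE9 is NOT PRINTED (cell NEW ESTIMATE).  This module ASSERTS NOTHING about Bałaban's functionals:
every declaration is [folklore] — elementary real analysis, and Gaussian (Fourier) integration on objects DEFINED here or in
`T4ComplexDilation` — and the manuscripts under audit are named for STRUCTURE only (ABSOLUTE RULE of the cell: no
internally-minted statement enters as a cited fact; nothing printed in the audited series is used as a hypothesis).

WHAT THIS LEAF ADDS AND WHY.  `T4ComplexDilation` (this lineage, generation 8) kernel-checked the complex-dilation mechanism
behind [H-dil] / [H-dil-N] — the binder `hlast` of `T4CouplingAnalyticity.stepTransfer_of_analyticOn` /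
`stepTransferV_of_analyticOn`: the step activity, as a function of its own LAST coupling `t = 1/g²`, extends holomorphically to
the relative discs `|z − s| ≤ c·s`, `s ≥ t₀`, with a uniform sup bound — on a ONE-BLOCK model, and left its quantitative
constraint as PROSE: the sup bound degrades by the volume factor `dilVol c n = (1 − c²)^{−n/4}`, EXACT (`norm_act_le_attained`)
and extensive in the number `n` of fluctuation variables, so «a dilation radius `c` uniform in the step is affordable only if
`c²` is of the order of the inverse number of fluctuation variables PER LOCALISED UNIT that the printed bounds can absorb» — with
NO localisation modelled.  THIS LEAF TYPES THAT SENTENCE, TWO-SIDEDLY, AND SHOWS WHERE IT COMES FROM: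
(§1) the volume factor is EXACTLY exponential, `dilVol c n = e^{a(c)·n}` with the VOLUME RATE `a(c) = −¼ log(1 − c²)`,
`c²/4 ≤ a(c) ≤ c²/(4(1 − c²))`; (§2) for a family with at most `ν·(1 + d)` variables at size `d` and real-coupling bounds
`M·e^{−κ d}`, decay survives the dilation with rate `κ − a(c)·ν`, positive iff `c < c_*(κ, ν) := √(1 − e^{−4κ/ν})`
(`volRate_mul_lt_iff`), and `4κ/(ν + 4κ) < c_*² ≤ 4κ/ν`: THE ADMISSIBLE APERTURE IS `c ≈ 2√(κ/ν)`, NOT A FREE ABSOLUTE CONSTANT;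
(§3) sufficiency in the literal `hlast` shape for genuine `act` families (`act_family_dilationAnalytic`, firing
`act_dilationAnalytic` BY NAME), the Lipschitz corollary (`act_family_lipschitz`, `act_lipschitz` BY NAME) whose constant
`(4M/t₀)·(e^{a(c)ν}/c)·e^{−(κ − a(c)ν) d}` carries the aperture TWICE, and `sqrt_le_exp_volRate_div`: `e^{a(c)ν}/c ≥ √(eν/2)` for
every aperture — the `1/c` of the Cauchy estimate and the volume factor cannot both be small, the best prefactor per localised
unit is `≍ √ν`; (§4) SHARPNESS: an honest family (`ν(1 + X)` variables, identity covariance, one-point reference space, constant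
non-negative insertion, ZERO action — a genuine instance of `act`) whose real-coupling functionals at `Re τ` equal `M·e^{−κ X}`
and whose complex activities at the tangency point `τ(s, c)` of the SAME disc have modulus EXACTLY `M·e^{a(c)ν}·e^{−(κ − a(c)ν)X}`
(`witness_norm_act`; equality in `localised_disc_bound`), hence do not decay at all once `a(c)·ν ≥ κ` (`witness_no_decay`):
the threshold cannot be removed on this route; (§5) THE OTHER SIDE OF THE LEDGER: the volume factor is produced by taking
absolute values, not by the dilation — for the character insertion `e^{iξ·x}` under the free quadratic action on `ℝⁿ`,
`‖act z‖ = e^{−|ξ|²·Re z/(2‖z‖²)} ≤ 1` for EVERY `Re z > 0` (`norm_charAct_eq`, `norm_charAct_le_one`: Mathlib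
`fourierIntegral_gaussian` coordinate by coordinate; the prefactors `(‖z‖/2π)^{n/2}` and `(2π/‖z‖)^{n/2}` cancel exactly), its
real-coupling absolute-value functional is `≡ 1` (`charAbsAct_eq_one`) so that `norm_act_le` evaluates to `dilVol c n ≥ e^{n c²/4}`
on the same object (`charAct_domination_gap`), and finite Fourier sums obey the WIENER-NORM bound `‖act z‖ ≤ Σ_m ‖a_m‖`
uniformly in `n` (`norm_act_wienerIns_le`).  READING [analysis, not a claim about print]: an aperture uniform in the step and
in the volume is compatible with the domination route only after localisation with `c² ≲ 4κ/ν`; n-uniform complex-coupling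
bounds require exploiting structure of the insertions (oscillation / analyticity in the fields, as a cluster expansion does),
which is exactly what [H-dil-N] for Bałaban's 𝐑-operation would have to supply and what is NOT PRINTED.

DICTIONARY (model ↦ print; an ANALOGY fixing what is modelled, NOT an identification; renders of [Balaban1987RG1] re-read by
the lineage and transcribed in the cell record `t4/T4-EST-NE9-P1.md` §2, cross-read): the size `d X` ↦ `d_j(X)` of the printed
localised bounds, p. 258 (0.27) *"|E^{(j)}(X, U_k)| ≤ E₀ exp(−κ(L^jη)^{−1}) exp(−½κd_j(X))"* and (0.29)
*"|V^{(j)}(X, U_k)| ≤ O(1)(L^jη)^{4+α} exp(−κd_j(X)), α > 0"*; the count `ν·(1 + d X)` ↦ the number of fluctuation variables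
`B(b)` living in a localisation domain of that size (p. 268: *"Denoting the remaining variables by B we have B′ = CB … the
measure becomes a Gaussian measure in variables B"*); `κ`, `M` ↦ the printed decay rate and uniform constant of such bounds at
REAL couplings; `c` ↦ the aperture of the discs of [H-dil-N]; `act`, `absAct`, `dilVol`, `tangent` ↦ as in `T4ComplexDilation`
(one normalised block integral BEFORE the logarithm and BEFORE any cluster expansion).  The (2.13)/(2.14) activities of Bałaban
are NOT instances of `act`, and whether their localised pieces carry `ν·(1 + d_j(X))` variables with a step-independent `ν` is a
question about [Balaban1988RG2Cluster]'s localisation that this leaf does NOT answer (recorded for the carver).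

## What is typed and proved (all [folklore]; 0 sorry)

§1 `volRate` (`a(c)`), `volRate_nonneg`, **`dilVol_eq_exp`** `dilVol c n = exp(a(c)·n)`, `sq_div_four_le_volRate`, `volRate_le`.
§2 `apertureBound` (`c_*(κ, ν)`), **`volRate_mul_lt_iff`** `a(c)·ν < κ ↔ c < c_*` (`ν > 0`, `0 ≤ c`, `c² < 1`), `apertureBound_sq`,
   `apertureBound_sq_le` (`c_*² ≤ 4κ/ν`), `lt_apertureBound_sq` (`4κ/(ν + 4κ) < c_*²`, `κ > 0`), `volRate_mul_lt_of_sq_le`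
   (`c²(ν + 4κ) ≤ 4κ ⇒ a(c)ν < κ`).
§3 `dilVol_mul_decay_le` (the arithmetic), **`localised_disc_bound`** (abstract dominated families), **`act_family_dilationAnalytic`**
   (genuine `act` families, dependent types `ιX X`, `Ω X`: `∀ X, ∃ D, DifferentiableOn ℂ (act …) D ∧ (∀ z ∈ D, ‖act … z‖ ≤
   M e^{a(c)ν} e^{−(κ − a(c)ν) d X}) ∧ ∀ s ≥ t₀, closedBall s (c s) ⊆ D`), `act_family_lipschitz`, **`sqrt_le_exp_volRate_div`**.
§4 `unitAct` / `unitAbsAct` (the honest witness, `differentiableOn_unitAct`), `unitAbsAct_eq`, `norm_unitAct_tangent`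
   (`norm_act_le_sharp` BY NAME), `witnessMass`, `witness_absAct` (`= M e^{−κX}`), **`witness_norm_act`**
   (`= M e^{a(c)ν} e^{−(κ − a(c)ν)X}`), **`witness_no_decay`** (`a(c)ν ≥ κ ⇒ ‖unitAct τ‖ ≥ M` for all `X`).
§5 `charIns`, `quadAct`, `charAct`, `norm_charIns`, `charIns_mul_boltzmann`, `integrable_fourier_factor`,
   `integrable_char_boltzmann`, **`blockInt_char`** (exact Gaussian Fourier integral), `norm_fourier_factor`, **`norm_charAct_eq`**,
   **`norm_charAct_le_one`**, **`charAbsAct_eq_one`**, `charAct_domination_gap`, `wienerIns`, `act_wienerIns_eq` (linearity in the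
   insertion), **`norm_act_wienerIns_le`**.

WHAT THIS SHOWS AND WHAT IT DOES NOT.  Shows (kernel): on the domination route of `T4ComplexDilation` the aperture of [H-dil-N]
is tied to the localisation by the two-sided threshold `a(c)·ν < κ`, with all constants explicit, and the Lipschitz constant it
feeds into `StepTransfer` carries `e^{a(c)ν}/c ≥ √(eν/2)`; and the volume factor is absent for insertions whose complex-coupling
expectation can be computed through their Fourier structure.  Does NOT show: [H-dil] / [H-dil-N] for Bałaban's 𝐑-operation, any
value of `κ`, `ν`, `M` for the printed scheme, any statement about the logarithm / cluster expansion / large fields, nor NE9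
(cell NEW ESTIMATE).  The typed wall of node U3 on this route is UNCHANGED: the binder `hlast` of
`T4CouplingAnalyticity.stepTransferV_of_analyticOn` for Bałaban's step with `M₁ j = M·exp(−A₀(log t_j)^{p₀})`, (W2)–(W4) and the
k-uniform per-unit action bound of the log layer (record `t4/T4-EST-NE9-P1.md` §4, §16; GAPS G-ne9p1-1 … 13) — this leaf adds
to [H-dil-N] the explicit rider that on the domination route its aperture must satisfy `c < c_*(κ, ν)` per localised unit.

CITATION HEADER (lean-in-tree rule 2026-08-18).  Source quoted (STRUCTURE/CONTEXT only, pp. 258, 268 as above): T. Bałaban,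
*Renormalization group approach to lattice gauge field theories. I.*, Commun. Math. Phys. **109**, 249–301 (1987)
[Balaban1987RG1] (cell paper B12; held `paper:balaban1987-cmp109-rg-i-small-field`).  Named for framing only:
[Balaban1988RG2Cluster] (B13), [Balaban1988Convergent] (B14), [Balaban1989LargeFieldII] (B16).  The Bałaban papers are
manuscripts UNDER ADJUDICATION by the audit cell `pub-balaban`: NOTHING printed in them is asserted here.  Kernel inputs imported
BY NAME: `T4ComplexDilation` v1.1 (this lineage, p189052: `dilVol`, `dilVol_pow_four`, `exp_le_dilVol`, `dilVol_le_exp`, `act`,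
`absAct`, `blockInt`, `invNorm`, `gaussNorm`, `norm_invNorm`, `norm_gaussNorm_sq_mul`, `gaussNorm_ne_zero`, `act_dilationAnalytic`,
`act_lipschitz`, `differentiableOn_act`, `absAct_action_zero`, `norm_act_le_sharp`, `tangent`, `tangent_re_pos`) and through it
`T4CouplingAnalyticity` v1.6 and `Dimock2015.AnalyticLipschitz` (J. Dimock's printed "analyticity ⇒ Lipschitz" mechanism
[Dimock2015], PUBLISHED and outside the audited series); Mathlib (`fourierIntegral_gaussian`, `integrable_cexp_quadratic`,
`integral_gaussian`, `MeasureTheory.integral_fintype_prod_volume_eq_prod`, `Integrable.fintype_prod`, `Complex.norm_cpow_real`);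
it modifies nothing.  NEW LEAF of unit `b2b-balaban-t4-ne9-p1-g10` (NE9 prover P1, analytic-dependence route, generation 10;
journal ONLINE + CLAIM T4-U3.E-NE9-PROVE-P1j* 2026-08-19T16:59:11Z); v1.
-/

noncomputable section

open Complex Metric Set MeasureTheory Matrix
open scoped BigOperators
open Literature.MathematicalPhysics.QuantumFieldTheory.Balaban1983to89.T4CouplingAnalyticity
open Literature.MathematicalPhysics.QuantumFieldTheory.Balaban1983to89.T4ComplexDilation

namespace Literature.MathematicalPhysics.QuantumFieldTheory.Balaban1983to89.T4DilationAperture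

/-! ## §1  The volume RATE `a(c) = −¼·log(1 − c²)`: `dilVol c n = e^{a(c)·n}` -/

/-- THE VOLUME RATE of a dilation of aperture `c`: `a(c) = −¼·log(1 − c²)`, so that the volume factor of
`T4ComplexDilation` is `dilVol c n = (1 − c²)^{−n/4} = e^{a(c)·n}` — the price PER FLUCTUATION VARIABLE, in the exponent.
[folklore] -/
def volRate (c : ℝ) : ℝ := -(1 / 4) * Real.log (1 - c ^ 2)

/-- `a(0) = 0`. [folklore] -/
@[simp] theorem volRate_zero : volRate 0 = 0 := by simp [volRate]

/-- `a(c) ≥ 0` for `c² < 1`. [folklore] -/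
theorem volRate_nonneg {c : ℝ} (hc : c ^ 2 < 1) : 0 ≤ volRate c := by
  have h1 : 0 < 1 - c ^ 2 := by linarith
  have : Real.log (1 - c ^ 2) ≤ 0 := Real.log_nonpos h1.le (by nlinarith [sq_nonneg c])
  unfold volRate
  nlinarith

/-- **`dilVol c n = e^{a(c)·n}`** (`c² < 1`): the volume factor is EXACTLY exponential in the number of variables with rate
`a(c)`. [folklore] -/
theorem dilVol_eq_exp {c : ℝ} (hc : c ^ 2 < 1) (n : ℕ) : dilVol c n = Real.exp (volRate c * n) := by
  have h1 : 0 < 1 - c ^ 2 := by linarith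
  have h4 : dilVol c n ^ 4 = Real.exp (volRate c * n) ^ 4 := by
    rw [dilVol_pow_four hc, ← Real.exp_nat_mul, inv_pow, ← Real.exp_log (pow_pos h1 n), ← Real.exp_neg,
      Real.log_pow]
    congr 1
    unfold volRate
    push_cast
    ring
  exact (pow_left_inj₀ (dilVol_nonneg c n) (Real.exp_nonneg _) (by norm_num : (4 : ℕ) ≠ 0)).1 h4

/-- TWO-SIDED: `c²/4 ≤ a(c)` (from `exp_le_dilVol`). [folklore] -/
theorem sq_div_four_le_volRate {c : ℝ} (hc : c ^ 2 < 1) : c ^ 2 / 4 ≤ volRate c := by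
  have h := exp_le_dilVol hc 1
  rw [dilVol_eq_exp hc, Nat.cast_one, one_mul, mul_one, Real.exp_le_exp] at h
  exact h

/-- TWO-SIDED: `a(c) ≤ c²/(4(1 − c²))` (from `dilVol_le_exp`). [folklore] -/
theorem volRate_le {c : ℝ} (hc : c ^ 2 < 1) : volRate c ≤ c ^ 2 / (4 * (1 - c ^ 2)) := by
  have h := dilVol_le_exp hc 1
  rw [dilVol_eq_exp hc, Nat.cast_one, one_mul, mul_one, Real.exp_le_exp] at h
  exact h

/-! ## §2  The APERTURE BOUND `c_*(κ, ν) = √(1 − e^{−4κ/ν})`: `a(c)·ν < κ ↔ c < c_*` -/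

/-- THE APERTURE BOUND of the domination route: `c_*(κ, ν) = √(1 − e^{−4κ/ν})` — for a localised family with `ν`
fluctuation variables per unit of decay size and real-coupling decay rate `κ`, the complex activities keep a positive
decay rate `κ − a(c)·ν` on the dilation discs iff the aperture satisfies `c < c_*(κ, ν)` (`volRate_mul_lt_iff`); and
`4κ/(ν + 4κ) ≤ c_*² ≤ 4κ/ν` (below), i.e. `c_* ≈ 2√(κ/ν)` for `κ ≪ ν`. [folklore] -/
def apertureBound (κ ν : ℝ) : ℝ := Real.sqrt (1 - Real.exp (-(4 * κ / ν)))

/-- `c_* ≥ 0`. [folklore] -/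
theorem apertureBound_nonneg (κ ν : ℝ) : 0 ≤ apertureBound κ ν := Real.sqrt_nonneg _

/-- **THE THRESHOLD**: for `ν > 0`, `0 ≤ c`, `c² < 1`: `a(c)·ν < κ ↔ c < c_*(κ, ν)`. [folklore] -/
theorem volRate_mul_lt_iff {c κ ν : ℝ} (hν : 0 < ν) (hc0 : 0 ≤ c) (hc : c ^ 2 < 1) :
    volRate c * ν < κ ↔ c < apertureBound κ ν := by
  have h1 : 0 < 1 - c ^ 2 := by linarith
  have key : volRate c * ν < κ ↔ -(4 * κ / ν) < Real.log (1 - c ^ 2) := by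
    unfold volRate
    constructor
    · intro h
      have h' : -Real.log (1 - c ^ 2) * ν < 4 * κ := by nlinarith
      have h'' : -Real.log (1 - c ^ 2) < 4 * κ / ν := by rwa [lt_div_iff₀ hν]
      linarith
    · intro h
      have h' : -Real.log (1 - c ^ 2) < 4 * κ / ν := by linarith
      have h'' : -Real.log (1 - c ^ 2) * ν < 4 * κ := by rwa [lt_div_iff₀ hν] at h'
      nlinarith
  rw [key, Real.lt_log_iff_exp_lt h1, apertureBound, Real.lt_sqrt hc0]
  constructor <;> intro h <;> linarith

/-- `c_*(κ, ν)² = 1 − e^{−4κ/ν}` for `κ/ν ≥ 0`. [folklore] -/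
theorem apertureBound_sq {κ ν : ℝ} (hν : 0 < ν) (hκ : 0 ≤ κ) :
    apertureBound κ ν ^ 2 = 1 - Real.exp (-(4 * κ / ν)) := by
  have h0 : 0 ≤ 1 - Real.exp (-(4 * κ / ν)) := by
    rw [sub_nonneg, Real.exp_le_one_iff]
    have : 0 ≤ 4 * κ / ν := by positivity
    linarith
  rw [apertureBound, Real.sq_sqrt h0]

/-- UPPER BOUND `c_*² ≤ 4κ/ν`: the admissible aperture is at most `2√(κ/ν)`. [folklore] -/
theorem apertureBound_sq_le {κ ν : ℝ} (hν : 0 < ν) (hκ : 0 ≤ κ) : apertureBound κ ν ^ 2 ≤ 4 * κ / ν := by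
  rw [apertureBound_sq hν hκ]
  have := Real.add_one_le_exp (-(4 * κ / ν))
  linarith

/-- LOWER BOUND `4κ/(ν + 4κ) < c_*²` (`κ > 0`): apertures with `c²·(ν + 4κ) ≤ 4κ` are admissible. [folklore] -/
theorem lt_apertureBound_sq {κ ν : ℝ} (hν : 0 < ν) (hκ : 0 < κ) : 4 * κ / (ν + 4 * κ) < apertureBound κ ν ^ 2 := by
  rw [apertureBound_sq hν hκ.le]
  set x : ℝ := 4 * κ / ν with hx
  have hx0 : 0 < x := by positivity
  have h1 : Real.exp (-x) < (1 + x)⁻¹ := by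
    rw [Real.exp_neg]
    exact (inv_lt_inv₀ (Real.exp_pos x) (by linarith)).2 (by linarith [Real.add_one_lt_exp hx0.ne'])
  have h2 : 4 * κ / (ν + 4 * κ) = 1 - (1 + x)⁻¹ := by
    rw [hx]
    field_simp
    ring
  rw [h2]
  linarith

/-- A SUFFICIENT APERTURE: `c ≥ 0`, `c²·(ν + 4κ) ≤ 4κ`, `κ > 0`, `ν > 0` ⇒ `a(c)·ν < κ`. [folklore] -/
theorem volRate_mul_lt_of_sq_le {c κ ν : ℝ} (hν : 0 < ν) (hκ : 0 < κ) (hc0 : 0 ≤ c)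
    (hc2 : c ^ 2 * (ν + 4 * κ) ≤ 4 * κ) : volRate c * ν < κ := by
  have hpos : 0 < ν + 4 * κ := by positivity
  have hle : c ^ 2 ≤ 4 * κ / (ν + 4 * κ) := by rwa [le_div_iff₀ hpos]
  have hlt1 : 4 * κ / (ν + 4 * κ) < 1 := by rw [div_lt_one hpos]; linarith
  have hc : c ^ 2 < 1 := lt_of_le_of_lt hle hlt1
  have hsq : c ^ 2 < apertureBound κ ν ^ 2 := lt_of_le_of_lt hle (lt_apertureBound_sq hν hκ)
  rw [volRate_mul_lt_iff hν hc0 hc]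
  exact lt_of_pow_lt_pow_left₀ 2 (apertureBound_nonneg κ ν) hsq

/-! ## §3  LOCALISATION ABSORBS THE VOLUME FACTOR INTO THE DECAY RATE (sufficiency, abstract and for `act` families) -/

/-- THE ARITHMETIC OF THE THRESHOLD: with `n ≤ ν·(1 + d)` variables and a real-coupling bound `M·e^{−κ d}`, the dilated
bound `dilVol c n · M e^{−κ d}` is at most `M·e^{a(c)ν}·e^{−(κ − a(c)ν)·d}` — the volume factor costs the constant `e^{a ν}`
and the DECAY RATE `a(c)·ν`. [folklore] -/
theorem dilVol_mul_decay_le {c ν κ M d : ℝ} {n : ℕ} (hc : c ^ 2 < 1) (hn : (n : ℝ) ≤ ν * (1 + d)) (hM : 0 ≤ M) :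
    dilVol c n * (M * Real.exp (-(κ * d)))
      ≤ M * Real.exp (volRate c * ν) * Real.exp (-((κ - volRate c * ν) * d)) := by
  rw [dilVol_eq_exp hc]
  have ha := volRate_nonneg hc
  have h1 : Real.exp (volRate c * n) ≤ Real.exp (volRate c * (ν * (1 + d))) :=
    Real.exp_le_exp.2 (mul_le_mul_of_nonneg_left hn ha)
  have hrhs : M * Real.exp (volRate c * ν) * Real.exp (-((κ - volRate c * ν) * d))
      = Real.exp (volRate c * (ν * (1 + d))) * (M * Real.exp (-(κ * d))) := by
    rw [show volRate c * (ν * (1 + d)) = volRate c * ν + volRate c * ν * d by ring, Real.exp_add,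
      show -((κ - volRate c * ν) * d) = volRate c * ν * d + -(κ * d) by ring, Real.exp_add]
    ring
  rw [hrhs]
  exact mul_le_mul_of_nonneg_right h1 (mul_nonneg hM (Real.exp_nonneg _))

/-- **SUFFICIENCY (abstract localised family).**  A family of complex activities `G X` on domains `D X`, dominated as in
`T4ComplexDilation.norm_act_le` by `dilVol c (vol X) · B X` with `vol X ≤ ν·(1 + d X)` variables and real-coupling bounds
`B X ≤ M·e^{−κ·d X}`, obeys `‖G X z‖ ≤ M e^{a(c)ν} · e^{−(κ − a(c)ν)·d X}` on `D X`: exponential decay in the size SURVIVES the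
dilation with the rate lowered by `a(c)·ν`, positive iff `c < c_*(κ, ν)` (§2). [folklore] -/
theorem localised_disc_bound {P : Type*} {G : P → ℂ → ℂ} {D : P → Set ℂ} {vol : P → ℕ} {B d : P → ℝ}
    {c ν κ M : ℝ} (hc : c ^ 2 < 1) (hM : 0 ≤ M) (hvol : ∀ X, (vol X : ℝ) ≤ ν * (1 + d X))
    (hB : ∀ X, B X ≤ M * Real.exp (-(κ * d X))) (hdom : ∀ X, ∀ z ∈ D X, ‖G X z‖ ≤ dilVol c (vol X) * B X) :
    ∀ X, ∀ z ∈ D X, ‖G X z‖ ≤ M * Real.exp (volRate c * ν) * Real.exp (-((κ - volRate c * ν) * d X)) :=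
  fun X z hz => (hdom X z hz).trans
    ((mul_le_mul_of_nonneg_left (hB X) (dilVol_nonneg _ _)).trans (dilVol_mul_decay_le hc (hvol X) hM))

section Family

variable {P : Type*} {ιX : P → Type*} [∀ X, Fintype (ιX X)] [∀ X, DecidableEq (ιX X)] {Ω : P → Type*}
  [∀ X, MeasurableSpace (Ω X)]

/-- **SUFFICIENCY FOR GENUINE `act` FAMILIES — the `hlast` shape with decay.**  A family of model activities
`act (A X) (μ X) (f X) (S X)` (one normalised cut-off Boltzmann block integral per index `X`, `T4ComplexDilation` §5) with
`card (ιX X) ≤ ν·(1 + d X)` fluctuation variables and the printed KIND of input — real couplings `r ≥ (1 − c)t₀`, absolute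
values, `absAct ≤ M·e^{−κ·d X}` uniformly in the coupling — is, for EVERY `X`, holomorphic on a domain containing the discs
`|z − s| ≤ c·s`, `s ≥ t₀`, with the sup bound `M e^{a(c)ν}·e^{−(κ − a(c)ν)·d X}`: LITERALLY the binder `hlast` of
`T4CouplingAnalyticity.stepTransferV_of_analyticOn` per localised piece, with the decay rate `κ − a(c)·ν`
(`act_dilationAnalytic` BY NAME + §3 arithmetic). [folklore] -/
theorem act_family_dilationAnalytic (A : ∀ X, Matrix (ιX X) (ιX X) ℝ) (hA : ∀ X, (A X).PosDef)
    {μ : ∀ X, Measure (Ω X)} {f : ∀ X, Ω X → ℂ} (hf : ∀ X, Integrable (f X) (μ X)) {S : ∀ X, Ω X → ℝ}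
    (hS : ∀ X, Measurable (S X)) {S₀ : P → ℝ} (hS₀ : ∀ X x, |S X x| ≤ S₀ X) {t₀ c M κ ν : ℝ} {d : P → ℝ}
    (ht₀ : 0 < t₀) (hc0 : 0 ≤ c) (hc : c < 1) (hM : 0 ≤ M)
    (hvol : ∀ X, (Fintype.card (ιX X) : ℝ) ≤ ν * (1 + d X))
    (hB : ∀ X, ∀ r : ℝ, (1 - c) * t₀ ≤ r → absAct (A X) (μ X) (f X) (S X) r ≤ M * Real.exp (-(κ * d X))) :
    ∀ X, ∃ D : Set ℂ, DifferentiableOn ℂ (act (A X) (μ X) (f X) (S X)) D ∧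
      (∀ z ∈ D, ‖act (A X) (μ X) (f X) (S X) z‖
        ≤ M * Real.exp (volRate c * ν) * Real.exp (-((κ - volRate c * ν) * d X))) ∧
      ∀ s ∈ Set.Ici t₀, closedBall (s : ℂ) (c * s) ⊆ D := by
  intro X
  have hc2 : c ^ 2 < 1 := by nlinarith
  obtain ⟨D, hD, hbd, hdisc⟩ := act_dilationAnalytic (A X) (hA X) (hf X) (hS X) (hS₀ X) ht₀ hc0 hc (hB X)
  exact ⟨D, hD, fun z hz => (hbd z hz).trans (dilVol_mul_decay_le hc2 (hvol X) hM), hdisc⟩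

/-- **CAUCHY ⇒ LIPSCHITZ for the family**: `‖act_X s − act_X s′‖ ≤ (4·M e^{a(c)ν}·e^{−(κ − a(c)ν) d X}/(c·t₀))·|s − s′|` for
`s, s′ ≥ t₀` — the last-coupling Lipschitz constant decays in the size at rate `κ − a(c)ν` AND inherits the factor `1/c`
(`act_lipschitz` BY NAME), so on this route the aperture enters the NE9 constants twice: `c < c_*(κ, ν)` and `ℓ ∝ 1/c`.
[folklore] -/
theorem act_family_lipschitz (A : ∀ X, Matrix (ιX X) (ιX X) ℝ) (hA : ∀ X, (A X).PosDef)
    {μ : ∀ X, Measure (Ω X)} {f : ∀ X, Ω X → ℂ} (hf : ∀ X, Integrable (f X) (μ X)) {S : ∀ X, Ω X → ℝ}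
    (hS : ∀ X, Measurable (S X)) {S₀ : P → ℝ} (hS₀ : ∀ X x, |S X x| ≤ S₀ X) {t₀ c M κ ν : ℝ} {d : P → ℝ}
    (ht₀ : 0 < t₀) (hc0 : 0 < c) (hc : c < 1) (hM : 0 ≤ M)
    (hvol : ∀ X, (Fintype.card (ιX X) : ℝ) ≤ ν * (1 + d X))
    (hB : ∀ X, ∀ r : ℝ, (1 - c) * t₀ ≤ r → absAct (A X) (μ X) (f X) (S X) r ≤ M * Real.exp (-(κ * d X)))
    {s s' : ℝ} (hs : t₀ ≤ s) (hs' : t₀ ≤ s') (X : P) :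
    ‖act (A X) (μ X) (f X) (S X) s - act (A X) (μ X) (f X) (S X) s'‖
      ≤ 4 * (M * Real.exp (volRate c * ν) * Real.exp (-((κ - volRate c * ν) * d X))) / (c * t₀) * |s - s'| := by
  have hc2 : c ^ 2 < 1 := by nlinarith
  have h := act_lipschitz (A X) (hA X) (hf X) (hS X) (hS₀ X) ht₀ hc0 hc (hB X) hs hs'
  refine h.trans (mul_le_mul_of_nonneg_right ?_ (abs_nonneg _))
  exact div_le_div_of_nonneg_right (mul_le_mul_of_nonneg_left (dilVol_mul_decay_le hc2 (hvol X) hM) (by norm_num))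
    (mul_pos hc0 ht₀).le

end Family

/-- **THE `1/c` PRICE CANNOT BE OPTIMISED AWAY.**  The aperture-dependent prefactor `e^{a(c)ν}/c` of the family's Lipschitz
constant (`act_family_lipschitz` at `d X = 0`: `ℓ = (4M/t₀)·e^{a(c)ν}/c`) satisfies `e^{a(c)ν}/c ≥ √(e·ν/2)` for EVERY aperture
`0 < c`, `c² < 1` (optimum near `c² = 2/ν`): on the domination route the last-coupling Lipschitz constant per localised unit
carries at least a factor `√(e ν/2)`, `ν` = fluctuation variables per unit of size — small apertures pay in `1/c`, large
ones in the volume factor. [folklore] -/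
theorem sqrt_le_exp_volRate_div {c ν : ℝ} (hν : 0 ≤ ν) (hc0 : 0 < c) (hc : c ^ 2 < 1) :
    Real.sqrt (Real.exp 1 * ν / 2) ≤ Real.exp (volRate c * ν) / c := by
  have ha := sq_div_four_le_volRate hc
  have h1 : Real.exp (ν * c ^ 2 / 4) ≤ Real.exp (volRate c * ν) := Real.exp_le_exp.2 (by nlinarith)
  -- `e·u ≤ e^u` with `u = ν c²/2`
  have h2 : Real.exp 1 * (ν * c ^ 2 / 2) ≤ Real.exp (ν * c ^ 2 / 2) := by
    have h := Real.add_one_le_exp (ν * c ^ 2 / 2 - 1)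
    have e : Real.exp (ν * c ^ 2 / 2) = Real.exp 1 * Real.exp (ν * c ^ 2 / 2 - 1) := by
      rw [← Real.exp_add]; congr 1; ring
    rw [e]
    exact mul_le_mul_of_nonneg_left (by linarith) (Real.exp_nonneg _)
  have h3 : (Real.sqrt (Real.exp 1 * ν / 2) * c) ^ 2 ≤ Real.exp (ν * c ^ 2 / 4) ^ 2 := by
    rw [mul_pow, Real.sq_sqrt (by positivity), ← Real.exp_nat_mul]
    have e : Real.exp (((2 : ℕ) : ℝ) * (ν * c ^ 2 / 4)) = Real.exp (ν * c ^ 2 / 2) := by congr 1; push_cast; ring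
    rw [e]
    nlinarith [h2]
  have h4 : Real.sqrt (Real.exp 1 * ν / 2) * c ≤ Real.exp (ν * c ^ 2 / 4) :=
    (pow_le_pow_iff_left₀ (mul_nonneg (Real.sqrt_nonneg _) hc0.le) (Real.exp_nonneg _) two_ne_zero).1 h3
  rw [le_div_iff₀ hc0]
  exact h4.trans h1

/-! ## §4  SHARPNESS OF THE THRESHOLD: an honest family attaining the rate loss `a(c)·ν` on every disc -/

/-- THE HONEST WITNESS ACTIVITY with `n` fluctuation variables: identity covariance on `ℝⁿ`, the one-point reference space
with its Dirac measure, the constant non-negative insertion `m`, ZERO action — a genuine instance of `T4ComplexDilation.act`.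
[folklore] -/
def unitAct (n : ℕ) (m : ℝ) : ℂ → ℂ :=
  act (1 : Matrix (Fin n) (Fin n) ℝ) (Measure.dirac ()) (fun _ : Unit => ((m : ℝ) : ℂ)) (fun _ => 0)

/-- Its real-coupling absolute-value functional (`T4ComplexDilation.absAct`). [folklore] -/
def unitAbsAct (n : ℕ) (m : ℝ) : ℝ → ℝ :=
  absAct (1 : Matrix (Fin n) (Fin n) ℝ) (Measure.dirac ()) (fun _ : Unit => ((m : ℝ) : ℂ)) (fun _ => 0)

/-- The witness activity is holomorphic on the right half-plane (`differentiableOn_act` BY NAME). [folklore] -/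
theorem differentiableOn_unitAct (n : ℕ) (m : ℝ) : DifferentiableOn ℂ (unitAct n m) {z | 0 < z.re} :=
  differentiableOn_act (1 : Matrix (Fin n) (Fin n) ℝ) (integrable_const _) measurable_const (S₀ := 0)
    (fun _ => by simp)

/-- `unitAbsAct n m r = ‖N_1(r)‖⁻¹·m` (`m ≥ 0`). [folklore] -/
theorem unitAbsAct_eq (n : ℕ) {m : ℝ} (hm : 0 ≤ m) (r : ℝ) :
    unitAbsAct n m r = ‖gaussNorm (1 : Matrix (Fin n) (Fin n) ℝ) (r : ℂ)‖⁻¹ * m := by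
  unfold unitAbsAct
  rw [absAct_action_zero _ _ (fun _ => hm)]
  simp

/-- At the tangency point `τ(s,c)` of the disc `|z − s| ≤ c·s` the witness attains the volume factor:
`‖unitAct n m τ‖ = e^{a(c)·n} · unitAbsAct n m (Re τ)` (`norm_act_le_sharp` BY NAME). [folklore] -/
theorem norm_unitAct_tangent (n : ℕ) {m s c : ℝ} (hm : 0 ≤ m) (hs : 0 < s) (hc : c ^ 2 < 1) :
    ‖unitAct n m (tangent s c)‖ = Real.exp (volRate c * n) * unitAbsAct n m (tangent s c).re := by
  have h := norm_act_le_sharp (1 : Matrix (Fin n) (Fin n) ℝ) Matrix.PosDef.one (Measure.dirac ())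
    (g := fun _ : Unit => m) (fun _ => hm) hs hc
  rw [Fintype.card_fin, dilVol_eq_exp hc] at h
  exact h

/-- THE WITNESS MASS for `ν·(1 + X)` variables: chosen so that the real-coupling functional at `Re τ(s,c)` EQUALS the
printed-type decay `M·e^{−κ·X}`. [folklore] -/
def witnessMass (ν : ℕ) (s c κ M : ℝ) (X : ℕ) : ℝ :=
  M * Real.exp (-(κ * X)) *
    ‖gaussNorm (1 : Matrix (Fin (ν * (1 + X))) (Fin (ν * (1 + X))) ℝ) ((tangent s c).re : ℂ)‖

/-- The witness mass is non-negative (`M ≥ 0`). [folklore] -/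
theorem witnessMass_nonneg (ν : ℕ) {s c κ M : ℝ} (hM : 0 ≤ M) (X : ℕ) : 0 ≤ witnessMass ν s c κ M X :=
  mul_nonneg (mul_nonneg hM (Real.exp_nonneg _)) (norm_nonneg _)

/-- The witness family's real-coupling functional at `Re τ` decays at rate `κ` in the size: `= M·e^{−κ X}`. [folklore] -/
theorem witness_absAct (ν : ℕ) {s c κ M : ℝ} (hM : 0 ≤ M) (hs : 0 < s) (hc : c ^ 2 < 1) (X : ℕ) :
    unitAbsAct (ν * (1 + X)) (witnessMass ν s c κ M X) (tangent s c).re = M * Real.exp (-(κ * X)) := by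
  rw [unitAbsAct_eq _ (witnessMass_nonneg ν hM X), witnessMass]
  have hN : ‖gaussNorm (1 : Matrix (Fin (ν * (1 + X))) (Fin (ν * (1 + X))) ℝ) ((tangent s c).re : ℂ)‖ ≠ 0 :=
    norm_ne_zero_iff.2 (gaussNorm_ne_zero _ Matrix.PosDef.one (by rw [Complex.ofReal_re]; exact tangent_re_pos hs hc))
  field_simp

/-- **THE RATE LOSS `a(c)·ν` IS ATTAINED.**  For every disc centre `s > 0`, aperture `0 ≤ c`, `c² < 1`, density `ν` of
variables per unit size, rate `κ` and constant `M ≥ 0`, the honest family (`ν(1 + X)` variables, zero action, constant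
non-negative insertion, Dirac reference measure) has real-coupling functionals `= M·e^{−κ X}` at `Re τ` (`witness_absAct`)
and complex activities of modulus EXACTLY `M·e^{a(c)ν}·e^{−(κ − a(c)ν)·X}` at the tangency point `τ(s,c)` of the same disc:
the conclusion of `localised_disc_bound` holds with EQUALITY there. [folklore] -/
theorem witness_norm_act (ν : ℕ) {s c κ M : ℝ} (hM : 0 ≤ M) (hs : 0 < s) (hc : c ^ 2 < 1) (X : ℕ) :
    ‖unitAct (ν * (1 + X)) (witnessMass ν s c κ M X) (tangent s c)‖
      = M * Real.exp (volRate c * ν) * Real.exp (-((κ - volRate c * ν) * X)) := by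
  rw [norm_unitAct_tangent _ (witnessMass_nonneg ν hM X) hs hc, witness_absAct ν hM hs hc X]
  have e1 : Real.exp (volRate c * ((ν * (1 + X) : ℕ) : ℝ)) = Real.exp (volRate c * ν) * Real.exp (volRate c * ν * X) := by
    rw [← Real.exp_add]; congr 1; push_cast; ring
  have e2 : Real.exp (-((κ - volRate c * ν) * X)) = Real.exp (volRate c * ν * X) * Real.exp (-(κ * X)) := by
    rw [← Real.exp_add]; congr 1; ring
  rw [e1, e2]
  ring

/-- **NO DECAY BEYOND THE THRESHOLD.**  If `a(c)·ν ≥ κ` the complex activities of the witness family do NOT decay in the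
size at the tangency points — `‖unitAct τ‖ ≥ M` for every `X` — although their real-coupling functionals decay at rate `κ`
there (`witness_absAct`): on the domination route the aperture threshold `c < c_*(κ, ν)` of §2 cannot be removed.
[folklore] -/
theorem witness_no_decay (ν : ℕ) {s c κ M : ℝ} (hM : 0 ≤ M) (hs : 0 < s) (hc : c ^ 2 < 1)
    (hκ : κ ≤ volRate c * ν) (X : ℕ) :
    M ≤ ‖unitAct (ν * (1 + X)) (witnessMass ν s c κ M X) (tangent s c)‖ := by
  rw [witness_norm_act ν hM hs hc X]
  have h1 : 1 ≤ Real.exp (volRate c * ν) :=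
    Real.one_le_exp (mul_nonneg (volRate_nonneg hc) (Nat.cast_nonneg _))
  have h2 : 1 ≤ Real.exp (-((κ - volRate c * ν) * X)) :=
    Real.one_le_exp (by nlinarith [Nat.cast_nonneg (α := ℝ) X])
  calc M = M * 1 * 1 := by ring
    _ ≤ M * Real.exp (volRate c * ν) * Real.exp (-((κ - volRate c * ν) * X)) := by gcongr

/-! ## §5  NO VOLUME FACTOR FOR TRANSLATION-CHARACTER (Fourier / Wiener-class) INSERTIONS

The volume factor `(1 − c²)^{−n/4}` is the price of DOMINATION (absolute values inside the integral), not of the dilation: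
for the character insertion `e^{iξ·x}` under the free quadratic action on `ℝⁿ` the dilated normalised activity is computed
EXACTLY by Gaussian Fourier integration (Mathlib `fourierIntegral_gaussian`) — `‖act z‖ = e^{−|ξ|²·Re z/(2‖z‖²)} ≤ 1` for
EVERY `Re z > 0`, uniformly in `n`, with NO disc restriction and NO volume factor —, while its real-coupling absolute-value
functional is `≡ 1`, so the domination bound `norm_act_le` yields `dilVol c n ≥ e^{n c²/4}` for the same object; finite
Fourier sums are bounded by their Wiener norm `Σ|a_m|`. -/

section Fourier

variable {n : ℕ}

/-- The CHARACTER INSERTION `e^{iξ·x} = ∏_j e^{iξ_j x_j}` on `ℝⁿ`. [folklore] -/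
def charIns (ξ : Fin n → ℝ) (x : Fin n → ℝ) : ℂ := ∏ j, cexp (I * (ξ j : ℂ) * (x j : ℂ))

/-- The FREE QUADRATIC ACTION `|x|²/2` on `ℝⁿ` (unbounded — the differentiability lemmas of `T4ComplexDilation` §4 are not
invoked in this section; only the definitions `act`, `absAct` and the bound `norm_act_le` are). [folklore] -/
def quadAct (x : Fin n → ℝ) : ℝ := ∑ j, x j ^ 2 / 2

/-- THE CHARACTER ACTIVITY: `T4ComplexDilation.act` with identity covariance, Lebesgue reference measure on `ℝⁿ`, the
character insertion and the free quadratic action — the normalised dilated Gaussian expectation of `e^{iξ·x}`. [folklore] -/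
def charAct (n : ℕ) (ξ : Fin n → ℝ) : ℂ → ℂ :=
  act (1 : Matrix (Fin n) (Fin n) ℝ) (volume : Measure (Fin n → ℝ)) (charIns ξ) quadAct

/-- `|e^{iξ·x}| = 1`. [folklore] -/
theorem norm_charIns (ξ x : Fin n → ℝ) : ‖charIns ξ x‖ = 1 := by
  unfold charIns
  rw [norm_prod]
  refine Finset.prod_eq_one fun j _ => ?_
  rw [Complex.norm_exp]
  simp

/-- The dilated integrand factorises over the coordinates. [folklore] -/
theorem charIns_mul_boltzmann (ξ : Fin n → ℝ) (z : ℂ) (x : Fin n → ℝ) :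
    charIns ξ x * cexp (-(z * (quadAct x : ℝ)))
      = ∏ j, (cexp (I * (ξ j : ℂ) * (x j : ℂ)) * cexp (-(z / 2) * (x j : ℂ) ^ 2)) := by
  rw [Finset.prod_mul_distrib, charIns, ← Complex.exp_sum, ← Complex.exp_sum]
  congr 2
  unfold quadAct
  push_cast
  rw [Finset.mul_sum, ← Finset.sum_neg_distrib]
  exact Finset.sum_congr rfl fun j _ => by ring

/-- One-dimensional integrability of `e^{iξx − (z/2)x²}` (`Re z > 0`; Mathlib `integrable_cexp_quadratic`). [folklore] -/
theorem integrable_fourier_factor {z : ℂ} (hz : 0 < z.re) (ξ : ℝ) :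
    Integrable (fun x : ℝ => cexp (I * (ξ : ℂ) * (x : ℂ)) * cexp (-(z / 2) * (x : ℂ) ^ 2)) := by
  have hb : 0 < (z / 2).re := by simp; positivity
  have : (fun x : ℝ => cexp (I * (ξ : ℂ) * (x : ℂ)) * cexp (-(z / 2) * (x : ℂ) ^ 2))
      = fun x : ℝ => cexp (-(z / 2) * (x : ℂ) ^ 2 + I * (ξ : ℂ) * x + 0) := by
    funext x
    rw [← Complex.exp_add]
    congr 1
    ring
  rw [this]
  exact integrable_cexp_quadratic hb _ _

/-- Integrability of the dilated character integrand on `ℝⁿ` (`Re z > 0`). [folklore] -/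
theorem integrable_char_boltzmann (ξ : Fin n → ℝ) {z : ℂ} (hz : 0 < z.re) :
    Integrable (fun x : Fin n → ℝ => charIns ξ x * cexp (-(z * (quadAct x : ℝ)))) (volume : Measure (Fin n → ℝ)) := by
  have h : (fun x : Fin n → ℝ => charIns ξ x * cexp (-(z * (quadAct x : ℝ))))
      = fun x => ∏ j, (cexp (I * (ξ j : ℂ) * (x j : ℂ)) * cexp (-(z / 2) * (x j : ℂ) ^ 2)) := by
    funext x; exact charIns_mul_boltzmann ξ z x
  rw [h]
  exact MeasureTheory.Integrable.fintype_prod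
    (f := fun j (x : ℝ) => cexp (I * (ξ j : ℂ) * (x : ℂ)) * cexp (-(z / 2) * (x : ℂ) ^ 2))
    (fun j => integrable_fourier_factor hz (ξ j))

/-- **EXACT GAUSSIAN FOURIER INTEGRATION** of the dilated block integral: `∫ e^{iξ·x} e^{−z|x|²/2} dx =
∏_j (2π/z)^{1/2} e^{−ξ_j²/(2z)}` (Mathlib `fourierIntegral_gaussian`, coordinate by coordinate). [folklore] -/
theorem blockInt_char (ξ : Fin n → ℝ) {z : ℂ} (hz : 0 < z.re) :
    blockInt (volume : Measure (Fin n → ℝ)) (charIns ξ) quadAct z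
      = ∏ j, (((Real.pi : ℂ) / (z / 2)) ^ (1 / 2 : ℂ) * cexp (-((ξ j : ℂ)) ^ 2 / (4 * (z / 2)))) := by
  have hb : 0 < (z / 2).re := by simp; positivity
  unfold blockInt
  simp_rw [charIns_mul_boltzmann]
  rw [MeasureTheory.integral_fintype_prod_volume_eq_prod (E := fun _ => ℝ)
    (f := fun j (x : ℝ) => cexp (I * (ξ j : ℂ) * (x : ℂ)) * cexp (-(z / 2) * (x : ℂ) ^ 2))]
  exact Finset.prod_congr rfl fun j _ => fourierIntegral_gaussian hb _

/-- Modulus of one factor: `|(2π/z)^{1/2} e^{−ξ²/(2z)}| = (2π/‖z‖)^{1/2}·e^{−ξ²·Re z/(2‖z‖²)}`. [folklore] -/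
theorem norm_fourier_factor {z : ℂ} (hz : 0 < z.re) (ξ : ℝ) :
    ‖((Real.pi : ℂ) / (z / 2)) ^ (1 / 2 : ℂ) * cexp (-((ξ : ℂ)) ^ 2 / (4 * (z / 2)))‖
      = (2 * Real.pi / ‖z‖) ^ (1 / 2 : ℝ) * Real.exp (-(ξ ^ 2 * (z.re / (2 * ‖z‖ ^ 2)))) := by
  have hz0 : z ≠ 0 := fun h => by simp [h] at hz
  rw [norm_mul, show (1 / 2 : ℂ) = ((1 / 2 : ℝ) : ℂ) by push_cast; ring, Complex.norm_cpow_real, Complex.norm_exp]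
  congr 1
  · rw [norm_div, norm_div, Complex.norm_real, Real.norm_of_nonneg Real.pi_pos.le, Complex.norm_ofNat]
    congr 1
    field_simp
  · congr 1
    have e : -((ξ : ℂ)) ^ 2 / (4 * (z / 2)) = ((-(ξ ^ 2 / 2) : ℝ) : ℂ) * z⁻¹ := by
      push_cast
      field_simp
      ring
    rw [e, Complex.re_ofReal_mul, Complex.inv_re, ← Complex.sq_norm]
    ring

/-- **NO VOLUME FACTOR**: `‖charAct n ξ z‖ = e^{−|ξ|²·Re z/(2‖z‖²)}` for every `Re z > 0` — the prefactors
`(‖z‖/2π)^{n/2}` of the dilated normalisation and `(2π/‖z‖)^{n/2}` of the block integral CANCEL EXACTLY. [folklore] -/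
theorem norm_charAct_eq (ξ : Fin n → ℝ) {z : ℂ} (hz : 0 < z.re) :
    ‖charAct n ξ z‖ = Real.exp (-((∑ j, ξ j ^ 2) * (z.re / (2 * ‖z‖ ^ 2)))) := by
  have hz0 : 0 < ‖z‖ := norm_pos_iff.2 (fun h => by simp [h] at hz)
  unfold charAct act
  rw [norm_mul, norm_invNorm, blockInt_char ξ hz, norm_prod, Matrix.det_one, Real.sqrt_one, mul_one,
    Fintype.card_fin]
  simp_rw [norm_fourier_factor hz]
  rw [Finset.prod_mul_distrib, Finset.prod_const, Finset.card_univ, Fintype.card_fin, ← Real.exp_sum, ← mul_assoc]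
  have h1 : (‖z‖ / (2 * Real.pi)) ^ ((n : ℝ) / 2) * ((2 * Real.pi / ‖z‖) ^ (1 / 2 : ℝ)) ^ n = 1 := by
    rw [show ((n : ℝ) / 2) = (1 / 2 : ℝ) * n by ring, Real.rpow_mul_natCast (by positivity), ← mul_pow,
      ← Real.mul_rpow (by positivity) (by positivity),
      show ‖z‖ / (2 * Real.pi) * (2 * Real.pi / ‖z‖) = 1 by field_simp, Real.one_rpow, one_pow]
  rw [h1, one_mul]
  congr 1
  rw [Finset.sum_mul, ← Finset.sum_neg_distrib]

/-- **`‖charAct n ξ z‖ ≤ 1`** for every `Re z > 0`: uniformly in the number of variables `n`, in `ξ`, and in `z` — no disc,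
no aperture, no volume factor. [folklore] -/
theorem norm_charAct_le_one (ξ : Fin n → ℝ) {z : ℂ} (hz : 0 < z.re) : ‖charAct n ξ z‖ ≤ 1 := by
  rw [norm_charAct_eq ξ hz, Real.exp_le_one_iff]
  have h1 : 0 ≤ ∑ j, ξ j ^ 2 := Finset.sum_nonneg fun j _ => sq_nonneg _
  have h2 : 0 ≤ z.re / (2 * ‖z‖ ^ 2) := by positivity
  nlinarith [mul_nonneg h1 h2]

/-- The character activity's REAL-COUPLING ABSOLUTE-VALUE FUNCTIONAL is identically `1` (`r > 0`): `|e^{iξ·x}| = 1` and the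
real Gaussian normalises itself (`integral_gaussian`, `norm_gaussNorm_sq_mul`). [folklore] -/
theorem charAbsAct_eq_one (ξ : Fin n → ℝ) {r : ℝ} (hr : 0 < r) :
    absAct (1 : Matrix (Fin n) (Fin n) ℝ) (volume : Measure (Fin n → ℝ)) (charIns ξ) quadAct r = 1 := by
  have hr' : 0 < ((r : ℂ)).re := by rw [Complex.ofReal_re]; exact hr
  unfold absAct
  have hint : (fun x : Fin n → ℝ => ‖charIns ξ x‖ * Real.exp (-(r * quadAct x)))
      = fun x => ∏ j, Real.exp (-(r / 2) * x j ^ 2) := by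
    funext x
    rw [norm_charIns, one_mul, ← Real.exp_sum]
    congr 1
    unfold quadAct
    rw [Finset.mul_sum, ← Finset.sum_neg_distrib]
    exact Finset.sum_congr rfl fun j _ => by ring
  rw [hint, MeasureTheory.integral_fintype_prod_volume_eq_pow (E := ℝ) (f := fun x : ℝ => Real.exp (-(r / 2) * x ^ 2)),
    integral_gaussian, Fintype.card_fin]
  have hN := norm_gaussNorm_sq_mul (1 : Matrix (Fin n) (Fin n) ℝ) Matrix.PosDef.one hr'
  rw [Matrix.det_one, mul_one, Complex.norm_real, Real.norm_of_nonneg hr.le, Fintype.card_fin] at hN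
  have hNpos : 0 < ‖gaussNorm (1 : Matrix (Fin n) (Fin n) ℝ) (r : ℂ)‖ :=
    norm_pos_iff.2 (gaussNorm_ne_zero _ Matrix.PosDef.one hr')
  have hs : Real.sqrt (Real.pi / (r / 2)) ^ n = ‖gaussNorm (1 : Matrix (Fin n) (Fin n) ℝ) (r : ℂ)‖ := by
    have h2 : (Real.sqrt (Real.pi / (r / 2)) ^ n) ^ 2 = ‖gaussNorm (1 : Matrix (Fin n) (Fin n) ℝ) (r : ℂ)‖ ^ 2 := by
      have hrn : (0 : ℝ) < r ^ n := pow_pos hr n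
      apply mul_right_cancel₀ hrn.ne'
      rw [hN, ← pow_mul, mul_comm n 2, pow_mul, Real.sq_sqrt (by positivity), ← mul_pow]
      congr 1
      field_simp
    exact (pow_left_inj₀ (pow_nonneg (Real.sqrt_nonneg _) n) hNpos.le two_ne_zero).1 h2
  rw [hs, inv_mul_cancel₀ hNpos.ne']

/-- **THE CONTRAST, on one object.**  For the character activity and any aperture `c² < 1`: the truth is `‖charAct z‖ ≤ 1`
at every `Re z > 0`, while the domination bound `norm_act_le` of `T4ComplexDilation` evaluates to
`dilVol c n · absAct(Re z) = dilVol c n ≥ e^{n·c²/4}` — off by exactly the volume factor, unbounded in `n` at fixed aperture.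
[folklore] -/
theorem charAct_domination_gap (ξ : Fin n → ℝ) {z : ℂ} (hz : 0 < z.re) {c : ℝ} (hc : c ^ 2 < 1) :
    ‖charAct n ξ z‖ ≤ 1 ∧
      Real.exp (n * (c ^ 2 / 4))
        ≤ dilVol c n * absAct (1 : Matrix (Fin n) (Fin n) ℝ) (volume : Measure (Fin n → ℝ)) (charIns ξ) quadAct z.re :=
  ⟨norm_charAct_le_one ξ hz, by rw [charAbsAct_eq_one ξ hz, mul_one]; exact exp_le_dilVol hc n⟩

/-- A FINITE FOURIER SUM (Wiener-class) insertion `Σ_{m ∈ T} a_m e^{iξ_m·x}`. [folklore] -/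
def wienerIns {Λ : Type*} (T : Finset Λ) (a : Λ → ℂ) (ξ : Λ → Fin n → ℝ) (x : Fin n → ℝ) : ℂ :=
  ∑ m ∈ T, a m * charIns (ξ m) x

/-- Linearity of the model activity in the insertion: `act (Σ a_m e^{iξ_m·x}) = Σ a_m · charAct ξ_m`. [folklore] -/
theorem act_wienerIns_eq {Λ : Type*} (T : Finset Λ) (a : Λ → ℂ) (ξ : Λ → Fin n → ℝ) {z : ℂ} (hz : 0 < z.re) :
    act (1 : Matrix (Fin n) (Fin n) ℝ) (volume : Measure (Fin n → ℝ)) (wienerIns T a ξ) quadAct z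
      = ∑ m ∈ T, a m * charAct n (ξ m) z := by
  unfold charAct act blockInt wienerIns
  have h : (fun x : Fin n → ℝ => (∑ m ∈ T, a m * charIns (ξ m) x) * cexp (-(z * (quadAct x : ℝ))))
      = fun x => ∑ m ∈ T, a m * (charIns (ξ m) x * cexp (-(z * (quadAct x : ℝ)))) := by
    funext x
    rw [Finset.sum_mul]
    exact Finset.sum_congr rfl fun m _ => by ring
  rw [h, integral_finsetSum _ (fun m _ => (integrable_char_boltzmann (ξ m) hz).const_mul (a m)), Finset.mul_sum]
  refine Finset.sum_congr rfl fun m _ => ?_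
  rw [integral_const_mul]
  ring

/-- **WIENER-NORM BOUND, NO VOLUME FACTOR**: `‖act (Σ a_m e^{iξ_m·x}) z‖ ≤ Σ_m ‖a_m‖` for every `Re z > 0`, uniformly in
`n` — versus `dilVol c n · Σ‖a_m‖` from domination. [folklore] -/
theorem norm_act_wienerIns_le {Λ : Type*} (T : Finset Λ) (a : Λ → ℂ) (ξ : Λ → Fin n → ℝ) {z : ℂ} (hz : 0 < z.re) :
    ‖act (1 : Matrix (Fin n) (Fin n) ℝ) (volume : Measure (Fin n → ℝ)) (wienerIns T a ξ) quadAct z‖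
      ≤ ∑ m ∈ T, ‖a m‖ := by
  rw [act_wienerIns_eq T a ξ hz]
  refine (norm_sum_le _ _).trans (Finset.sum_le_sum fun m _ => ?_)
  rw [norm_mul]
  exact mul_le_of_le_one_right (norm_nonneg _) (norm_charAct_le_one (ξ m) hz)

end Fourier

end Literature.MathematicalPhysics.QuantumFieldTheory.Balaban1983to89.T4DilationAperture

end
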